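import Mathlib
import Literature.Computability.AlgebraicComplexity.StandardFamilies
import Summits.ValiantsHypothesis.ValiantsHypothesis.Theorems.ElementaryWordLengthWordPerSuperQuarticChainReadOnce

/-!
# Chain calculus for crux `ElementaryWordLength.WordPerSuperQuartic`, line `Sketch`:
# the rigidity floor `2b` of chain hardness (`chainHardness_floor`)

A *chain* is a product `Π_t (1 + x_{v_t} • N_t)` of `3 × 3` matrices over
`MvPolynomial (Fin n × Fin n) ℂ`, one factor per letter `(v_t, N_t)` (a variable and a constant
square-zero matrix).  Let `P := aeval φ (per_n)` be the block restriction of the permanent at the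
all-ones off-block point (`φ` keeps the diagonal block variables `x_ii`, `i < b`, and sends every
other variable to `1`), and `P' := P - P(0)`.  We prove: every chain of square-zero letters
computing `E_02(P') = Matrix.transvection 0 2 P'` has at least `2b` letters (`2 ≤ b`, `2b ≤ n`).

## Proof

* `P = Σ_σ x^{F(σ)}` with `F(σ) = {i : σ i = i ∧ i < b}` the block fixed points of `σ`
  (`hf_aeval_perPoly`), so the coefficient of `x_{i₀ i₀} x_{j j}` (`i₀ ≠ j`, both `< b`) in `P` is
  the number of permutations with block fixed points exactly `{i₀, j}`; the cyclic permutation of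
  the other `n - 2 ≥ 2` indices (`List.formPerm`, `hf_exists_perm_fixed`) is one of them, so this
  coefficient is nonzero (`hf_coeff_pair_ne_zero`), and it is also the coefficient in `P'`.
* Pigeonhole (`hf_sum_countP_le`): if the chain had fewer than `2b` letters, some block variable
  `x_{i₀ i₀}` would be read by at most one letter; by the two-reads lemma `chain_read_once`
  (`Theorems/ElementaryWordLengthWordPerSuperQuarticChainReadOnce.lean`) every monomial of `P'`
  divisible by `x_{i₀ i₀}` other than `x_{i₀ i₀}` itself has coefficient `0` — contradicting the
  first point with the monomial `x_{i₀ i₀} x_{j j}` (`hf_floor_of_twoReads`).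
-/

-- `Summit.ValiantsHypothesis.ValiantsHypothesis.…` is the tree's mandated single-conjunct layout.
set_option linter.dupNamespace false

namespace Summit.ValiantsHypothesis.ValiantsHypothesis.Theorems.WordPerSuperQuartic

open MvPolynomial

open Literature.Computability.AlgebraicComplexity (perPoly)

/-- Pigeonhole helper: for an injective family of values `f k`, the numbers of letters `e` of `L`
with `g e = f k` sum, over any finset of indices `k`, to at most the length of `L`. -/
private theorem hf_sum_countP_le {α β ι : Type*} [DecidableEq α] (S : Finset ι) (f : ι → α)
    (hf : Function.Injective f) (g : β → α) (L : List β) :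
    ∑ k ∈ S, L.countP (fun e => decide (g e = f k)) ≤ L.length := by
  induction L with
  | nil => simp only [List.countP_nil, Finset.sum_const_zero, List.length_nil, le_refl]
  | cons e L ih =>
    simp only [List.countP_cons, List.length_cons, Finset.sum_add_distrib, decide_eq_true_eq]
    have h1 : ∑ k ∈ S, (if g e = f k then 1 else 0) ≤ 1 := by
      rw [Finset.sum_boole, Nat.cast_id]
      exact Finset.card_le_one.mpr fun a ha a' ha' =>
        hf ((Finset.mem_filter.mp ha).2.symm.trans (Finset.mem_filter.mp ha').2)
    omega

/-- A permutation of `Fin n` with a prescribed fixed-point set `A`, provided the complement of `A`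
has at least two elements: the cyclic permutation of the complement. -/
private theorem hf_exists_perm_fixed {n : ℕ} (A : Finset (Fin n)) (hA : 2 ≤ Aᶜ.card) :
    ∃ σ : Equiv.Perm (Fin n), ∀ k, σ k = k ↔ k ∈ A := by
  refine ⟨(Aᶜ.toList).formPerm, fun k => ?_⟩
  by_cases hk : k ∈ A
  · refine ⟨fun _ => hk, fun _ => List.formPerm_apply_of_notMem ?_⟩
    rw [Finset.mem_toList, Finset.mem_compl]
    exact not_not.mpr hk
  · refine ⟨fun h => absurd h ?_, fun h => absurd h hk⟩
    refine (List.formPerm_apply_mem_ne_self_iff _ (Finset.nodup_toList _) k ?_).mpr ?_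
    · rw [Finset.mem_toList, Finset.mem_compl]
      exact hk
    · rw [Finset.length_toList]
      exact hA

/-- The block restriction of `per_n` at the all-ones off-block point, expanded:
`aeval φ (per_n) = Σ_σ x^{F(σ)}` with `F(σ) = {i : σ i = i ∧ i < b}` the block fixed points. -/
private theorem hf_aeval_perPoly (n b : ℕ) :
    MvPolynomial.aeval (fun v : Fin n × Fin n =>
        if v.1 = v.2 ∧ (v.1 : ℕ) < b then MvPolynomial.X v else MvPolynomial.C (1 : ℂ))
        (perPoly (Fin n) ℂ) =
      ∑ σ : Equiv.Perm (Fin n), monomial (∑ i ∈ Finset.univ.filter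
        (fun i : Fin n => σ i = i ∧ (i : ℕ) < b), Finsupp.single (i, i) 1) (1 : ℂ) := by
  rw [perPoly, Matrix.permanent, map_sum]
  refine Finset.sum_congr rfl fun σ _ => ?_
  rw [map_prod, monomial_sum_one, Finset.prod_filter]
  refine Finset.prod_congr rfl fun i _ => ?_
  rw [Matrix.mvPolynomialX_apply, aeval_X]
  dsimp only
  by_cases h : σ i = i
  · rw [h]
    split_ifs
    · rfl
    · exact C_1
  · rw [if_neg (fun hh => h hh.1), if_neg (fun hh => h hh.1), C_1]

/-- The pair coefficients of the block restriction at the all-ones point are positive: for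
distinct block indices `i₀, j` the coefficient of `x_{i₀ i₀} x_{j j}` is the number of permutations
whose block fixed points are exactly `{i₀, j}`, and the cycle on the other `n - 2 ≥ 2` indices is
one of them. -/
private theorem hf_coeff_pair_ne_zero (n b : ℕ) (hn : 4 ≤ n) (i₀ j : Fin n) (hij : i₀ ≠ j)
    (hi : (i₀ : ℕ) < b) (hj : (j : ℕ) < b) :
    MvPolynomial.coeff (Finsupp.single (i₀, i₀) 1 + Finsupp.single (j, j) 1)
      (MvPolynomial.aeval (fun v : Fin n × Fin n =>
        if v.1 = v.2 ∧ (v.1 : ℕ) < b then MvPolynomial.X v else MvPolynomial.C (1 : ℂ))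
        (perPoly (Fin n) ℂ)) ≠ 0 := by
  obtain ⟨σ₀, hσ₀⟩ := hf_exists_perm_fixed ({i₀, j} : Finset (Fin n))
    (by rw [Finset.card_compl, Fintype.card_fin, Finset.card_pair hij]; omega)
  rw [hf_aeval_perPoly, coeff_sum]
  simp only [coeff_monomial]
  rw [Finset.sum_boole, Nat.cast_ne_zero, Finset.card_ne_zero]
  refine ⟨σ₀, Finset.mem_filter.mpr ⟨Finset.mem_univ _, ?_⟩⟩
  have hF : Finset.univ.filter (fun i : Fin n => σ₀ i = i ∧ (i : ℕ) < b) = {i₀, j} := by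
    ext k
    simp only [Finset.mem_filter, Finset.mem_univ, true_and, hσ₀ k, Finset.mem_insert,
      Finset.mem_singleton]
    constructor
    · exact fun h => h.1
    · rintro (rfl | rfl)
      · exact ⟨Or.inl rfl, hi⟩
      · exact ⟨Or.inr rfl, hj⟩
  rw [hF, Finset.sum_pair hij]

/-- The floor, abstractly: if the pair coefficients `[x_{i₀ i₀} x_{j j}] P` (`i₀ ≠ j`, both `< b`)
are nonzero and every block variable read at most once by `L` occurs in `P - P(0)` only linearly
with a constant coefficient (the two-reads conclusion), then `L` has at least `2b` letters. -/
private theorem hf_floor_of_twoReads (n b : ℕ) (hb : 2 ≤ b) (hn : 2 * b ≤ n)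
    (P : MvPolynomial (Fin n × Fin n) ℂ)
    (hP : ∀ i₀ j : Fin n, i₀ ≠ j → (i₀ : ℕ) < b → (j : ℕ) < b →
      MvPolynomial.coeff (Finsupp.single (i₀, i₀) 1 + Finsupp.single (j, j) 1) P ≠ 0)
    (L : List ((Fin n × Fin n) × Matrix (Fin 3) (Fin 3) ℂ))
    (hRO : ∀ i : Fin n × Fin n, L.countP (fun e => decide (e.1 = i)) ≤ 1 →
      ∀ m : (Fin n × Fin n) →₀ ℕ, m i ≠ 0 → m ≠ Finsupp.single i 1 →
        MvPolynomial.coeff m (P - MvPolynomial.C (MvPolynomial.constantCoeff P)) = 0) :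
    2 * b ≤ L.length := by
  have hbn : b ≤ n := by omega
  by_contra hlt
  rw [not_le] at hlt
  -- pigeonhole: some block variable is read at most once
  obtain ⟨k, hk⟩ : ∃ k : Fin b,
      L.countP (fun e => decide (e.1 = (Fin.castLE hbn k, Fin.castLE hbn k))) ≤ 1 := by
    by_contra! hall
    have hle : 2 * b ≤ L.length :=
      calc 2 * b = ∑ _k : Fin b, 2 := by
            rw [Finset.sum_const, Finset.card_univ, Fintype.card_fin, smul_eq_mul, mul_comm]
        _ ≤ ∑ k : Fin b,
              L.countP (fun e => decide (e.1 = (Fin.castLE hbn k, Fin.castLE hbn k))) :=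
            Finset.sum_le_sum fun k _ => Nat.succ_le_of_lt (hall k)
        _ ≤ L.length :=
            hf_sum_countP_le _ (fun k : Fin b => (Fin.castLE hbn k, Fin.castLE hbn k))
              (fun a a' h => Fin.castLE_injective hbn (congrArg Prod.fst h)) Prod.fst L
    omega
  -- a second block index
  obtain ⟨k', hk'⟩ : ∃ k' : Fin b, k' ≠ k :=
    Fintype.exists_ne_of_one_lt_card (by rw [Fintype.card_fin]; omega) k
  have hij : Fin.castLE hbn k ≠ Fin.castLE hbn k' :=
    fun h => hk' (Fin.castLE_injective hbn h).symm
  -- the exponent vector of `x_{i₀ i₀} x_{j j}`, `i₀ := castLE k`, `j := castLE k'`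
  have h0 : (Finsupp.single (Fin.castLE hbn k, Fin.castLE hbn k) 1 +
      Finsupp.single (Fin.castLE hbn k', Fin.castLE hbn k') 1 : (Fin n × Fin n) →₀ ℕ)
        (Fin.castLE hbn k, Fin.castLE hbn k) ≠ 0 := by
    rw [Finsupp.add_apply, Finsupp.single_eq_same]
    omega
  have h1 : (Finsupp.single (Fin.castLE hbn k, Fin.castLE hbn k) 1 +
      Finsupp.single (Fin.castLE hbn k', Fin.castLE hbn k') 1 : (Fin n × Fin n) →₀ ℕ) ≠
        Finsupp.single (Fin.castLE hbn k, Fin.castLE hbn k) 1 := by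
    intro h
    have h' := DFunLike.congr_fun h (Fin.castLE hbn k', Fin.castLE hbn k')
    rw [Finsupp.add_apply, Finsupp.single_eq_same, Finsupp.single_apply,
      if_neg (fun hh => hij (congrArg Prod.fst hh))] at h'
    omega
  -- two-reads at `x_{i₀ i₀}` kills the coefficient of `x_{i₀ i₀} x_{j j}` in `P' = P - P(0)` ...
  have hc := hRO _ hk _ h0 h1
  rw [coeff_sub, coeff_C, if_neg (fun hh => h0 (by rw [← hh, Finsupp.zero_apply])),
    sub_zero] at hc
  -- ... which is the (nonzero) pair coefficient of `P`
  exact hP _ _ hij (by rw [Fin.val_castLE]; exact k.isLt)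
    (by rw [Fin.val_castLE]; exact k'.isLt) hc

/-- **The rigidity floor of chain hardness** (the `ε`-free, unconditional shadow of
`stub_chainHardness`): at the all-ones off-block point, every chain of square-zero letters reading
only diagonal block variables `x_ii`, `i < b` (`2 ≤ b`, `2b ≤ n`), and computing `E_02(P − P(0))`
for the block restriction `P` of `per_n`, has at least `2b` letters — every block variable is read
at least twice (two-reads, `chain_read_once`, plus the positivity of the pair coefficients
of `P`). -/
theorem chainHardness_floor : ∀ (n b : ℕ), 2 ≤ b → 2 * b ≤ n →
    ∀ L : List ((Fin n × Fin n) × Matrix (Fin 3) (Fin 3) ℂ),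
      (∀ e ∈ L, e.1.1 = e.1.2 ∧ (e.1.1 : ℕ) < b) →
      (∀ e ∈ L, e.2 * e.2 = 0) →
      (L.map (fun e => (1 : Matrix (Fin 3) (Fin 3) (MvPolynomial (Fin n × Fin n) ℂ)) +
          (MvPolynomial.X e.1 : MvPolynomial (Fin n × Fin n) ℂ) •
            e.2.map (MvPolynomial.C : ℂ → MvPolynomial (Fin n × Fin n) ℂ))).prod =
        Matrix.transvection (0 : Fin 3) 2
          (MvPolynomial.aeval (fun v : Fin n × Fin n =>
              if v.1 = v.2 ∧ (v.1 : ℕ) < b then MvPolynomial.X v else MvPolynomial.C (1 : ℂ))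
              (perPoly (Fin n) ℂ) -
            MvPolynomial.C (MvPolynomial.constantCoeff (MvPolynomial.aeval (fun v : Fin n × Fin n =>
              if v.1 = v.2 ∧ (v.1 : ℕ) < b then MvPolynomial.X v else MvPolynomial.C (1 : ℂ))
              (perPoly (Fin n) ℂ)))) →
      2 * b ≤ L.length := by
  intro n b hb hn L _ h2 h3
  exact hf_floor_of_twoReads n b hb hn _
    (fun i₀ j hij hi hj => hf_coeff_pair_ne_zero n b (by omega) i₀ j hij hi hj) L
    (chain_read_once L _ h2 h3)

end Summit.ValiantsHypothesis.ValiantsHypothesis.Theorems.WordPerSuperQuartic
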